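/-
Copyright (c) 2026. All rights reserved.
Released under Apache 2.0 license as described in the file LICENSE.
Authors: abc-iut cell, statement-typer seat abc-iut-L4-t9 (wave 2).
-/
import Literature.AnabelianGeometry.AbsoluteAnabelian.DiagramsOfCategories

/-!
# Cores from augmentations ([AbsTopIII] Def 3.5 (iii); the mechanism behind Cor 3.6 (i) / 3.7 (i))

S. Mochizuki, *Topics in absolute anabelian geometry III* [MochizukiAbsTopIII2015] (manuscript
`paper:url-5493eb38cbb7`), Def 3.5 (iii) pp. 75–76 (observables, cores) and the proof of Cor 3.6 (i)
p. 80: "assertion (i) is immediate from the definitions and the fact that the algorithms of Corollary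
1.10 are 'group-theoretic'" — i.e. every category of the diagram maps to the observation category
(`ℰ`, `Anab`, …) and every functor of the diagram commutes with these maps up to a given natural
isomorphism; composing these isomorphisms along paths yields a homotopy between any two
co-verticial paths ending at the observation vertex, and this family is a CORE.

This file makes that mechanism a CONSTRUCTION over abc-iut-L4-t2's Def 3.5 formalism
(`DiagramsOfCategories.lean`): from a `CoreAugmentation` of a diagram `𝒟` towards the observation
category of an extension datum `Y` (functors `aug_v : 𝒟_v ⥤ S` with isomorphisms
`𝒟_e ⋙ aug_w ≅ aug_v` for every edge and `Y.obsMap i ≅ aug_v` for every observation edge) we build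
the family of homotopies `coreFamily` on the extended diagram — boundary set = ALL co-verticial pairs
ending at the observation vertex, homotopy `ζ_{(γ₁,γ₂)} = (can_{γ₁}) ∘ (can_{γ₂})⁻¹` — verify the
axioms of Def 3.5 (ii) (the whiskering axiom via the path-composition law `pathIso_comp_hom_app`),
and conclude `IsCore` as soon as every vertex reaches the observation vertex
(`coreObservable_isCore`). Used by `AbsTopIII/BiAnabelianCoresProofs.lean` (Cor 3.7 (i)); available
to the Cor 3.6 (i) statements `CoreStmt4/5/6` of abc-iut-L4-t5 in the same way.
-/

set_option autoImplicit false

namespace Literature.AnabelianGeometry.AbsoluteAnabelian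

namespace DiagramOfCategories

open _root_.CategoryTheory _root_.Quiver

universe v u w

variable {V : Type w} [Quiver.{v} V] {D : DiagramOfCategories.{v, u, w} V} {X : ExtShape.{v} V}

/-! ## Paths out of the observation vertex of an observable shape are trivial -/

/-- In an extension shape without telecore edges, a path starting at the observation vertex ends
there. [cite: MochizukiAbsTopIII2015, Def 3.5 (iii) p.75] -/
theorem eq_obs_of_path_from_obs (hJ : ∀ a, IsEmpty (X.J a)) {d : X.Vertex} (r : Path X.obs d) :
    d = X.obs := by
  induction r with
  | nil => rfl
  | cons r e ih =>
    subst ih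
    rename_i c
    cases c with
    | obs => rfl
    | base b => exact ((hJ b).false e).elim

/-- In an extension shape without telecore edges, the only path from the observation vertex to
itself is the empty path. [cite: MochizukiAbsTopIII2015, Def 3.5 (iii) p.75] -/
theorem path_obs_eq_nil (hJ : ∀ a, IsEmpty (X.J a)) :
    ∀ {d : X.Vertex} (r : Path X.obs d) (hd : d = X.obs), hd ▸ r = Path.nil
  | _, .nil, _ => rfl
  | _, .cons r e, hd => by
    have hc := eq_obs_of_path_from_obs hJ r
    subst hc
    cases hd
    exact (PEmpty.elim e : _)

/-! ## Augmentations and the induced core structure -/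

variable (D) in
/-- A **core augmentation** of `𝒟` towards the observation category `S = Y.S` of an extension datum
`Y` (no telecore edges): a functor `aug_v : 𝒟_v ⥤ S` at each vertex, an isomorphism
`𝒟_e ⋙ aug_w ≅ aug_v` for each edge `e : v ⟶ w` ("the Galois group is undisturbed by `𝒟_e`"), and
`Y.obsMap i ≅ aug_v` for each observation edge. [cite: MochizukiAbsTopIII2015, Cor 3.6 (i) p.80] -/
structure CoreAugmentation (Y : D.ExtData X) where
  isEmpty_J : ∀ a, IsEmpty (X.J a)
  /-- the augmentation functors `𝒟_v ⥤ S` -/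
  aug : ∀ a : V, D.obj a ⥤ Y.S
  /-- compatibility 2-cells along the edges of `𝒟` -/
  iso : ∀ {a b : V} (e : a ⟶ b), D.map e ⋙ aug b ≅ aug a
  /-- the observation functors are (isomorphic to) the augmentations -/
  obsIso : ∀ {a : V} (i : X.I a), Y.obsMap i ≅ aug a

namespace CoreAugmentation

variable {Y : D.ExtData X} (A : D.CoreAugmentation Y)

/-- The augmentation extended to the extended diagram (the identity at the observation vertex).
[cite: MochizukiAbsTopIII2015, Cor 3.6 (i) p.80] -/
def augExt : ∀ a : X.Vertex, (D.extend Y).obj a ⥤ Y.S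
  | ExtVertex.base a => A.aug a
  | ExtVertex.obs => 𝟭 Y.S

/-- The compatibility 2-cells on the edges of the extended diagram.
[cite: MochizukiAbsTopIII2015, Cor 3.6 (i) p.80] -/
def isoExt : ∀ {a b : X.Vertex} (e : a ⟶ b), (D.extend Y).map e ⋙ A.augExt b ≅ A.augExt a
  | ExtVertex.base _, ExtVertex.base _, e => A.iso e
  | ExtVertex.base _, ExtVertex.obs, i => (Y.obsMap i).rightUnitor ≪≫ A.obsIso i
  | ExtVertex.obs, ExtVertex.base b, j => ((A.isEmpty_J b).false j).elim
  | ExtVertex.obs, ExtVertex.obs, e => (PEmpty.elim e : _)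

/-- The canonical isomorphism `𝒟_[γ] ⋙ aug_w ≅ aug_v` for a path `γ : v → w`, by composing the edge
2-cells. [cite: MochizukiAbsTopIII2015, Cor 3.6 (i) p.80] -/
def pathIso : ∀ {a b : X.Vertex} (p : Path a b), (D.extend Y).pathFunctor p ⋙ A.augExt b ≅ A.augExt a
  | _, _, .nil => eqToIso (by rw [pathFunctor_nil]; rfl)
  | _, _, .cons p e =>
    eqToIso (by rw [pathFunctor_cons]; rfl) ≪≫
      Functor.isoWhiskerLeft ((D.extend Y).pathFunctor p) (A.isoExt e) ≪≫ pathIso p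

/-- Components of `pathIso` on the empty path. [cite: MochizukiAbsTopIII2015, Cor 3.6 (i) p.80] -/
theorem pathIso_nil_hom_app (a : X.Vertex) (x : (D.extend Y).obj a) :
    (A.pathIso (Path.nil : Path a a)).hom.app x =
      eqToHom (by rw [pathFunctor_nil]; rfl) := by
  simp only [pathIso, eqToIso.hom, eqToHom_app]

/-- Components of `pathIso` on an extended path. [cite: MochizukiAbsTopIII2015, Cor 3.6 (i) p.80] -/
theorem pathIso_cons_hom_app {a b c : X.Vertex} (p : Path a b) (e : b ⟶ c)
    (x : (D.extend Y).obj a) :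
    (A.pathIso (p.cons e)).hom.app x =
      eqToHom (by rw [pathFunctor_cons]; rfl) ≫
        (A.isoExt e).hom.app (((D.extend Y).pathFunctor p).obj x) ≫ (A.pathIso p).hom.app x := by
  simp only [pathIso, Iso.trans_hom, eqToIso.hom, NatTrans.comp_app, eqToHom_app,
    Functor.isoWhiskerLeft_hom, Functor.whiskerLeft_app]
  rfl

/-- The path-composition law for `pathIso`, componentwise and heterogeneously (the object
`𝒟_[γ₃∘γ₁](x)` is only propositionally equal to `𝒟_[γ₁](𝒟_[γ₃](x))`).
[cite: MochizukiAbsTopIII2015, Cor 3.6 (i) p.80] -/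
theorem pathIso_comp_hom_app {c a : X.Vertex} (r : Path c a) :
    ∀ {b : X.Vertex} (p : Path a b) (x : (D.extend Y).obj c),
      (A.pathIso (r.comp p)).hom.app x ≍
        (A.pathIso p).hom.app (((D.extend Y).pathFunctor r).obj x) ≫ (A.pathIso r).hom.app x
  | _, .nil, x => by
    change (A.pathIso r).hom.app x ≍ _
    rw [pathIso_nil_hom_app]
    exact (eqToHom_comp_heq _ _).symm
  | _, .cons p e, x => by
    change (A.pathIso ((r.comp p).cons e)).hom.app x ≍ _
    rw [pathIso_cons_hom_app, pathIso_cons_hom_app]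
    simp only [Category.assoc, eqToHom_comp_heq_iff, heq_eqToHom_comp_iff]
    have hO : ((D.extend Y).pathFunctor (r.comp p)).obj x =
        ((D.extend Y).pathFunctor p).obj (((D.extend Y).pathFunctor r).obj x) := by
      rw [pathFunctor_comp]; rfl
    refine heq_comp (by rw [hO]) (by rw [hO]) rfl (by rw [hO]) ?_
    exact pathIso_comp_hom_app r p x

/-- For a path `γ` ending at the observation vertex, `pathIso` read as `𝒟_[γ] ≅ aug_v` (the
augmentation at the observation vertex is the identity). [cite: MochizukiAbsTopIII2015, Cor 3.6 (i) p.80] -/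
def coreIso {a : X.Vertex} (p : Path a X.obs) : (D.extend Y).pathFunctor p ≅ A.augExt a := A.pathIso p

/-- `coreIso` and `pathIso` have the same components. [cite: MochizukiAbsTopIII2015, Cor 3.6 (i) p.80] -/
theorem coreIso_hom_app {a : X.Vertex} (p : Path a X.obs) (x : (D.extend Y).obj a) :
    (A.coreIso p).hom.app x = (A.pathIso p).hom.app x := rfl

/-- The homotopy between two co-verticial paths ending at the observation vertex:
`(can_{γ₁}) ∘ (can_{γ₂})⁻¹`. [cite: MochizukiAbsTopIII2015, Cor 3.6 (i) p.80] -/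
def coreHom {a : X.Vertex} (p q : Path a X.obs) :
    (D.extend Y).pathFunctor p ⟶ (D.extend Y).pathFunctor q :=
  (A.coreIso p ≪≫ (A.coreIso q).symm).hom

/-- `coreHom` transported along a proof that the terminal vertex is the observation vertex (the
shape in which the family of homotopies consumes it). [cite: MochizukiAbsTopIII2015, Cor 3.6 (i) p.80] -/
def coreη {a b : X.Vertex} (h : b = X.obs) (p q : Path a b) :
    (D.extend Y).pathFunctor p ⟶ (D.extend Y).pathFunctor q := by
  subst h; exact A.coreHom p q

/-- `coreη` on the observation vertex is `coreHom`. [cite: MochizukiAbsTopIII2015, Cor 3.6 (i) p.80] -/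
theorem coreη_rfl {a : X.Vertex} (p q : Path a X.obs) : A.coreη rfl p q = A.coreHom p q := rfl

/-- Inverse components: if the `hom`-components of two isomorphisms of functors agree
heterogeneously at an object (of propositionally equal source), so do their `inv`-components.
[folklore] -/
private theorem inv_app_heq {C₁ : Type u} [Category.{v} C₁] {C₂ : Type u} [Category.{v} C₂]
    {F G F' : C₁ ⥤ C₂} (i : F ≅ G) (j : F' ≅ G) (x : C₁) (hF : F.obj x = F'.obj x)
    (h : i.hom.app x ≍ j.hom.app x) : i.inv.app x ≍ j.inv.app x := by
  have key : ∀ {P P' Q : C₂} (s : P ≅ Q) (t : P' ≅ Q), P = P' → s.hom ≍ t.hom → s.inv ≍ t.inv := by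
    intro P P' Q s t hP hh
    subst hP
    have hst : s = t := Iso.ext (eq_of_heq hh)
    subst hst
    rfl
  exact key (i.app x) (j.app x) hF h

/-- The path-composition law transported to `coreIso`: for `γ₃ : c → a` and `γ : a → v_𝒮`, the
components of `coreIso (γ ∘ γ₃)` and of `(𝒟_[γ₃] ◃ coreIso γ) ≪≫ pathIso γ₃` agree heterogeneously,
for `hom` and for `inv`. [cite: MochizukiAbsTopIII2015, Cor 3.6 (i) p.80] -/
theorem coreIso_comp_app {c a : X.Vertex} (r : Path c a) (p : Path a X.obs)
    (x : (D.extend Y).obj c) :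
    ((A.coreIso (r.comp p)).hom.app x ≍
      (Functor.isoWhiskerLeft ((D.extend Y).pathFunctor r) (A.coreIso p) ≪≫ A.pathIso r).hom.app x) ∧
    ((A.coreIso (r.comp p)).inv.app x ≍
      (Functor.isoWhiskerLeft ((D.extend Y).pathFunctor r) (A.coreIso p) ≪≫ A.pathIso r).inv.app x) := by
  have hhom : (A.coreIso (r.comp p)).hom.app x ≍
      (Functor.isoWhiskerLeft ((D.extend Y).pathFunctor r) (A.coreIso p) ≪≫ A.pathIso r).hom.app x :=
    A.pathIso_comp_hom_app r p x
  exact ⟨hhom, inv_app_heq _ _ x (by rw [pathFunctor_comp]) hhom⟩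

/-- **The core structure induced by an augmentation** (Def 3.5 (ii)/(iii)): boundary set = all
co-verticial pairs of paths ending at the observation vertex; homotopies `coreHom`.
[cite: MochizukiAbsTopIII2015, Cor 3.6 (i) p.80] -/
def coreFamily : (D.extend Y).HomotopyFamily where
  E := fun ⦃_ b⦄ _ _ => b = X.obs
  isSaturated :=
    { refl_left := fun _ _ _ _ h => h
      refl_right := fun _ _ _ _ h => h
      trans := fun _ _ _ _ _ h _ => h
      precomp := fun _ _ _ _ _ h _ => h
      postcomp := fun _ _ _ _ _ h r => by subst h; exact eq_obs_of_path_from_obs A.isEmpty_J r }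
  η := fun ⦃_ _⦄ ⦃p q⦄ h => A.coreη h p q
  η_refl := by
    intro a b p h
    subst h
    rw [coreη_rfl, coreHom, Iso.self_symm_id]
    rfl
  η_trans := by
    intro a b p q r h₁ h₂
    subst h₁
    simp only [coreη_rfl, coreHom, Iso.trans_hom, Iso.symm_hom, Category.assoc, Iso.inv_hom_id_assoc]
  η_whisker := by
    intro a b c d p q h r₁ r₂
    subst h
    have hd := eq_obs_of_path_from_obs A.isEmpty_J r₂
    subst hd
    have hr₂ := path_obs_eq_nil A.isEmpty_J r₂ rfl
    simp only at hr₂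
    subst hr₂
    ext x
    rw [NatTrans.comp_app, NatTrans.comp_app, eqToHom_app, eqToHom_app, Functor.whiskerLeft_app,
      Functor.whiskerRight_app]
    refine (conj_eqToHom_iff_heq' _ _ _ _).mpr ?_
    change (A.coreHom (r₁.comp p) (r₁.comp q)).app x ≍
      ((D.extend Y).pathFunctor Path.nil).map
        ((A.coreHom p q).app (((D.extend Y).pathFunctor r₁).obj x))
    refine HEq.trans ?_ (Functor.hcongr_hom ((D.extend Y).pathFunctor_nil _).symm _)
    rw [Functor.id_map]
    -- both sides as components of isomorphisms of functors
    have hP := A.coreIso_comp_app r₁ p x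
    have hQ := A.coreIso_comp_app r₁ q x
    have e₁ : ((D.extend Y).pathFunctor (r₁.comp p)).obj x =
        ((D.extend Y).pathFunctor r₁ ⋙ (D.extend Y).pathFunctor p).obj x := by rw [pathFunctor_comp]
    have e₂ : ((D.extend Y).pathFunctor (r₁.comp q)).obj x =
        ((D.extend Y).pathFunctor r₁ ⋙ (D.extend Y).pathFunctor q).obj x := by rw [pathFunctor_comp]
    have step : (A.coreHom (r₁.comp p) (r₁.comp q)).app x ≍
        ((Functor.isoWhiskerLeft ((D.extend Y).pathFunctor r₁) (A.coreIso p) ≪≫ A.pathIso r₁) ≪≫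
          (Functor.isoWhiskerLeft ((D.extend Y).pathFunctor r₁) (A.coreIso q) ≪≫
            A.pathIso r₁).symm).hom.app x := by
      rw [coreHom, Iso.trans_hom, NatTrans.comp_app, Iso.trans_hom, NatTrans.comp_app]
      exact heq_comp e₁ rfl e₂ hP.1 hQ.2
    refine step.trans (heq_of_eq ?_)
    rw [Iso.trans_symm, Iso.trans_assoc, Iso.self_symm_id_assoc]
    rfl

/-- The boundary paths of `coreFamily` end at the observation vertex (by definition).
[cite: MochizukiAbsTopIII2015, Def 3.5 (iii) p.75] -/
theorem coreFamily_terminal ⦃a b : X.Vertex⦄ ⦃p q : Path a b⦄ (h : A.coreFamily.E p q) :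
    b = X.obs := h

/-- The observable `(𝒟 ∪ {v_𝒮}, v_𝒮, coreFamily)`. [cite: MochizukiAbsTopIII2015, Def 3.5 (iii) p.75] -/
def coreObservable : D.Observable where
  shape := X
  isEmpty_J := A.isEmpty_J
  ext := Y
  H := A.coreFamily
  terminal_obs := A.coreFamily_terminal

/-- **An augmented diagram is a core** as soon as every vertex reaches the observation vertex.
[cite: MochizukiAbsTopIII2015, Cor 3.6 (i) p.80] -/
theorem coreObservable_isCore (hreach : ∀ a : V, Nonempty (Path (X.base a) X.obs)) :
    A.coreObservable.IsCore where
  boundary_all _ _ _ := rfl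
  reaches_obs := hreach

end CoreAugmentation

end DiagramOfCategories

/-! ## TODO-merge (dedup note, referee ref-l L2-F2, 2026-08-25)

This file and abc-iut-L4-t5's `DiagramCores.lean` (`DiagramOfCategories.OverData {N, μ}`,
`OverData.extendCore`, `coreObservable`, `isCore_coreObservable`; landed in the same commit) formalize
the SAME mechanism (Rmk 3.5.1 / Def 3.5 (iii) / proof of Cor 3.6 (i)), written independently within one
minute of each other. Dictionary: `CoreAugmentation Y` = `OverData Y.S` on `𝒟` (`aug ↦ N`, `iso ↦ μ`)
together with the observation-edge isomorphisms (`obsIso ↦` the argument `c` of `extendCore` /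
`coreObservable`) and `isEmpty_J ↦ hJ`; `CoreAugmentation.coreFamily` ↔ `coreFamily … (extendCore …)`;
`coreObservable` ↔ `coreObservable`; `coreObservable_isCore h` ↔ `isCore_coreObservable … h`.
-- TODO-merge abc-iut-L4-t5 / abc-iut-L4-lead: keep ONE of the two as canonical (L4-lead to rule);
-- the consumer `AbsTopIII/BiAnabelianCoresProofs.lean` (abc-iut-L4-t9) exists in both variants and
-- switches in one line; when ruled, the non-canonical file becomes a thin re-export or is retired
-- by the operator (`ledger module-retire`, with its dependants migrated first). -/

end Literature.AnabelianGeometry.AbsoluteAnabelian
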